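import Mathlib
import HarnessLib
import Literature.Analysis.FluidPDE.Tao2016AveragedNS.TaylorChainCertificate
import Summits.NavierStokesRegularity.NavierStokesRegularity.Theorems.TaylorModelRungThreeReadoutPackage
import Summits.NavierStokesRegularity.NavierStokesRegularity.Theorems.TaylorModelRungThreeReadoutG3Base
import Summits.NavierStokesRegularity.NavierStokesRegularity.Theorems.TaylorModelRungThreeReadoutG3Flow
import Summits.NavierStokesRegularity.NavierStokesRegularity.Theorems.TaylorModelRungThreeReadoutG3Tube
import Summits.NavierStokesRegularity.NavierStokesRegularity.Theorems.TaylorModelRungThreeReadoutG3Calc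

/-!
# Line `taylor-model` on crux K1b-DR (stmt-NavierStokesRegularity-23954) — stub G3 (`stub_tube : TubeLip`),
# helper file 5: flow-Lipschitz segment derivatives across the chain (legs, node calculus, existence)

For a valid certificate, an abstract flow package `φ` with the chain enclosure, an entry point `q` of stage `j`,
a time `t` of sub-step `s'`, and two states `z, z'` in the κ-box around `φ(q,t)` at window distance `d`
(the hypotheses of K1b-DR's LIP clause), with `y σ := z' + σ (z − z')`:

* `first_leg` / `first_leg_sub`: inside sub-step `s'` the σ-derivative of `φ(y σ, t')` exists with
  `|·| ≤ L1 s' · d · ω` ((F4) at the base `φ(q,t)`, `|φ(q,t)| ≤ mT + SpO` by self-restart, radius `κ`, guard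
  `bb (mT+SpO+κ) h < 1`), hence the node states at `Tn (s'+1)` are `L1 s'·|σ−σ'|·d`-close;
* `node_lip` / `node_dir`: at a node state of a restarted flow, `y ↦ φ(y, t'')` (`t'' ≤ h v`) is Lipschitz with
  constant `L1 v` on the κ-box and has two-sided directional derivatives ((F4) at that base);
* `deriv_advance` / `deriv_node`: EXISTENCE of the σ-derivative of `φ(y σ, ·)` at every node and in-step time
  after `t`, by induction over the nodes with the chain rule along a C¹ curve (`…G3Calc`) and the flow property;
* `K_nonneg` / `kappaB_nonneg`: the variation-defect coefficient and `κB` of every sub-step are non-negative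
  (needed to scale the frame bounds).

The frame transport, the last leg and the assembly of `KBlockLip` (three `Λ` clauses of `Readouts`) are in
`…TaylorModelRungThreeReadoutG3`. MODEL-lattice bookkeeping only (rung TL-M3 of the NS ladder); nothing here
is a statement about the Navier–Stokes equations.
-/

noncomputable section

-- the sub-problem namespace repeats the summit name by design (D-0017)
set_option linter.dupNamespace false

namespace Summit.NavierStokesRegularity.NavierStokesRegularity.Theorems.TaylorModelReadout.G3

open Set Filter
open Literature.Analysis.FluidPDE.TaoCascade Literature.Analysis.FluidPDE.TaoCascade.TaylorChain
open Summit.NavierStokesRegularity.NavierStokesRegularity.Theorems.TaylorModelReadout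

variable {cd : CertData} {j : ℕ} {φ : Flow}

/-! ### Majorant factors -/

/-- Monotonicity of `q ↦ 1/(1−q)²` below `1`. [folklore] -/
theorem one_div_sq_mono {q₁ q₂ : ℝ} (h12 : q₁ ≤ q₂) (h2 : q₂ < 1) :
    1 / (1 - q₁) ^ 2 ≤ 1 / (1 - q₂) ^ 2 :=
  one_div_le_one_div_of_le (pow_pos (by linarith) 2) (pow_le_pow_left₀ (by linarith) (by linarith) 2)

/-- The variational majorant factor of a base of size `m` and radius `ρ` with `m + ρ ≤ mT + SpO + κ`, at a time
`t' ≤ h s`, is at most `L1 s`. [folklore] -/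
theorem factor_le_L1 (hV : cd.Valid) (hj : j ≤ cd.N₀) {s : ℕ} (hs : s < cd.S j) {m ρ t' : ℝ}
    (h0 : 0 ≤ m + ρ) (hle : m + ρ ≤ cd.mT j s + cd.SpO j s + cd.κ j) (ht' : t' ∈ Icc 0 (cd.h j s)) :
    1 / (1 - cd.bb j * (m + ρ) * t') ^ 2 ≤ cd.L1 j s := by
  have hB := (hV.2.2.1 j hj).2.2.2.2.2.2.2 s hs
  have h7 : cd.bb j * (cd.mT j s + cd.SpO j s + cd.κ j) * cd.h j s < 1 := hB.2.2.2.2.2.2.1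
  have h8 : 1 / (1 - cd.bb j * (cd.mT j s + cd.SpO j s + cd.κ j) * cd.h j s) ^ 2 ≤ cd.L1 j s :=
    hB.2.2.2.2.2.2.2.1
  have hbb := bb_nonneg hV hj
  have hq : cd.bb j * (m + ρ) * t' ≤ cd.bb j * (cd.mT j s + cd.SpO j s + cd.κ j) * cd.h j s :=
    mul_le_mul (mul_le_mul_of_nonneg_left hle hbb) ht'.2 ht'.1 (mul_nonneg hbb (h0.trans hle))
  exact (one_div_sq_mono hq h7).trans h8

/-- The guard at a base of size `m` and radius `ρ` with `m + ρ ≤ mT + SpO + κ`, horizon `T ≤ h s`. [folklore] -/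
theorem guard_of_le_h (hV : cd.Valid) (hj : j ≤ cd.N₀) {s : ℕ} (hs : s < cd.S j) {m ρ T : ℝ}
    (h0 : 0 ≤ m + ρ) (hle : m + ρ ≤ cd.mT j s + cd.SpO j s + cd.κ j) (hT : T ∈ Icc 0 (cd.h j s)) :
    cd.bb j * (m + ρ) * T < 1 := by
  have hB := (hV.2.2.1 j hj).2.2.2.2.2.2.2 s hs
  have h7 : cd.bb j * (cd.mT j s + cd.SpO j s + cd.κ j) * cd.h j s < 1 := hB.2.2.2.2.2.2.1
  have hbb := bb_nonneg hV hj
  exact lt_of_le_of_lt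
    (mul_le_mul (mul_le_mul_of_nonneg_left hle hbb) hT.2 hT.1 (mul_nonneg hbb (h0.trans hle))) h7

/-! ### The first leg: inside the sub-step of the restart time -/

/-- FIRST LEG: the σ-derivative of `φ(y σ, t')` for `t + t'` inside sub-step `s'`, with `|·| ≤ L1 s' · d · ω`.
[folklore] -/
theorem first_leg (hV : cd.Valid) (hF : IsFlowPackage cd φ) (hC : ChainEnclosure cd φ) (hj : j ≤ cd.N₀)
    {q : Fin 4 → ℤ → ℝ} (hq : InPoly cd j q) {s' : ℕ} (hs' : s' < cd.S j) {t : ℝ} (h1 : cd.Tn j s' ≤ t)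
    (h2 : t ≤ cd.Tn j (s' + 1)) {z z' : Fin 4 → ℤ → ℝ} {d : ℝ}
    (hz : cd.InBall j (z - stAt φ j q t) (cd.κ j)) (hz' : cd.InBall j (z' - stAt φ j q t) (cd.κ j))
    (hzz : cd.InBall j (z - z') d) {t' : ℝ} (ht' : t' ∈ Icc 0 (cd.Tn j (s' + 1) - t))
    (i : Fin 4) (k : ℤ) (hk1 : -cd.Kb ≤ k) (hk2 : k ≤ cd.Ka) :
    ∃ ψ : ℝ → ℝ, ∀ σ ∈ Icc (0:ℝ) 1,
      HasDerivWithinAt (fun σ' : ℝ => φ j (z' + σ' • (z - z')) i k t') (ψ σ) (Icc 0 1) σ ∧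
      |ψ σ| ≤ cd.L1 j s' * d * cd.ω j k := by
  have hω := omega_pos hV hj
  have hκ := kappa_pos hV hj
  have hx := inBall_traj hV hC hj hq hs' h1 h2
  have hm0 : 0 ≤ cd.mT j s' + cd.SpO j s' := inBall_nonneg hV hω hx
  have hTn := Tn_succ hV hj hs'
  have hT0 : cd.Tn j (s' + 1) - t ∈ Icc 0 (cd.h j s') := ⟨by linarith, by linarith⟩
  have hg := guard_of_le_h hV hj hs' (m := cd.mT j s' + cd.SpO j s') (ρ := cd.κ j) (by linarith) le_rfl hT0
  obtain ⟨ψ, hψ⟩ := (hF j hj).2.2.2.2.1 (stAt φ j q t) (cd.mT j s' + cd.SpO j s') (cd.κ j)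
    (cd.Tn j (s' + 1) - t) hm0 hκ.le hx hT0.1 hg z z' d hz hz' hzz i k hk1 hk2 t' ht'
  have hd : 0 ≤ d := inBall_nonneg hV hω hzz
  have hfac := factor_le_L1 hV hj hs' (m := cd.mT j s' + cd.SpO j s') (ρ := cd.κ j) (by linarith) le_rfl
    (t' := t') ⟨ht'.1, ht'.2.trans hT0.2⟩
  refine ⟨ψ, fun σ hσ => ⟨(hψ σ hσ).1, (hψ σ hσ).2.trans ?_⟩⟩
  exact mul_le_mul_of_nonneg_right (mul_le_mul_of_nonneg_right hfac hd) (hω k).le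

/-- FIRST LEG, two points: the states `φ(y σ, t')`, `φ(y σ', t')` are `L1 s' · |σ−σ'| d`-close for `t + t'`
inside sub-step `s'`. [folklore] -/
theorem first_leg_sub (hV : cd.Valid) (hF : IsFlowPackage cd φ) (hC : ChainEnclosure cd φ) (hj : j ≤ cd.N₀)
    {q : Fin 4 → ℤ → ℝ} (hq : InPoly cd j q) {s' : ℕ} (hs' : s' < cd.S j) {t : ℝ} (h1 : cd.Tn j s' ≤ t)
    (h2 : t ≤ cd.Tn j (s' + 1)) {z z' : Fin 4 → ℤ → ℝ} {d : ℝ}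
    (hz : cd.InBall j (z - stAt φ j q t) (cd.κ j)) (hz' : cd.InBall j (z' - stAt φ j q t) (cd.κ j))
    (hzz : cd.InBall j (z - z') d) {σ σ' : ℝ} (hσ : σ ∈ Icc (0:ℝ) 1) (hσ' : σ' ∈ Icc (0:ℝ) 1)
    {t' : ℝ} (ht' : t' ∈ Icc 0 (cd.Tn j (s' + 1) - t)) :
    cd.InBall j (stAt φ j (z' + σ • (z - z')) t' - stAt φ j (z' + σ' • (z - z')) t')
      (cd.L1 j s' * (|σ - σ'| * d)) := by
  have hω := omega_pos hV hj
  have hκ := kappa_pos hV hj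
  have hx := inBall_traj hV hC hj hq hs' h1 h2
  have hm0 : 0 ≤ cd.mT j s' + cd.SpO j s' := inBall_nonneg hV hω hx
  have hTn := Tn_succ hV hj hs'
  have hT0 : cd.Tn j (s' + 1) - t ∈ Icc 0 (cd.h j s') := ⟨by linarith, by linarith⟩
  have hg := guard_of_le_h hV hj hs' (m := cd.mT j s' + cd.SpO j s') (ρ := cd.κ j) (by linarith) le_rfl hT0
  have hd : 0 ≤ d := inBall_nonneg hV hω hzz
  have hfac := factor_le_L1 hV hj hs' (m := cd.mT j s' + cd.SpO j s') (ρ := cd.κ j) (by linarith) le_rfl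
    (t' := t') ⟨ht'.1, ht'.2.trans hT0.2⟩
  have h := inBall_sub_of_F4 hF hj hm0 hκ.le hx hT0.1 hg (inBall_convex hz hz' hσ) (inBall_convex hz hz' hσ')
    (inBall_segment_sub hzz) ht'
  exact inBall_mono hω h (mul_le_mul_of_nonneg_right hfac (mul_nonneg (abs_nonneg _) hd))

/-! ### At a node state of a restarted flow: Lipschitz bound and directional derivatives -/

/-- A non-negative window radius for any state. [folklore] -/
theorem exists_radius (hω : ∀ k, 0 < cd.ω j k) (η : Fin 4 → ℤ → ℝ) : ∃ N : ℝ, 0 ≤ N ∧ cd.InBall j η N := by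
  classical
  refine ⟨∑ ik ∈ (Finset.univ ×ˢ Finset.Icc (-cd.Kb) cd.Ka : Finset (Fin 4 × ℤ)), |η ik.1 ik.2| / cd.ω j ik.2,
    Finset.sum_nonneg fun ik _ => div_nonneg (abs_nonneg _) (hω _).le, fun i k hk1 hk2 => ?_⟩
  have h1 : |η i k| / cd.ω j k ≤
      ∑ ik ∈ (Finset.univ ×ˢ Finset.Icc (-cd.Kb) cd.Ka : Finset (Fin 4 × ℤ)), |η ik.1 ik.2| / cd.ω j ik.2 :=
    Finset.single_le_sum (f := fun ik : Fin 4 × ℤ => |η ik.1 ik.2| / cd.ω j ik.2)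
      (fun ik _ => div_nonneg (abs_nonneg _) (hω _).le) (a := (i, k))
      (Finset.mem_product.mpr ⟨Finset.mem_univ _, Finset.mem_Icc.mpr ⟨hk1, hk2⟩⟩)
  rwa [div_le_iff₀ (hω k)] at h1

/-- NODE LIPSCHITZ: at the node state `p = φ(y₀, Tn v − t)` of a κ-restarted flow, `y ↦ φ(y, t'')` (`t'' ≤ h v`)
is Lipschitz with constant `L1 v · ω k` on `p + Ball(κ)` (component `(i,k)`). [folklore] -/
theorem node_lip (hV : cd.Valid) (hF : IsFlowPackage cd φ) (hC : ChainEnclosure cd φ) (hj : j ≤ cd.N₀)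
    {q : Fin 4 → ℤ → ℝ} (hq : InPoly cd j q) {s' : ℕ} (hs' : s' < cd.S j) {t : ℝ} (h1 : cd.Tn j s' ≤ t)
    (h2 : t ≤ cd.Tn j (s' + 1)) {y₀ : Fin 4 → ℤ → ℝ} (hy₀ : cd.InBall j (y₀ - stAt φ j q t) (cd.κ j))
    {v : ℕ} (hv : s' < v) (hvS : v < cd.S j) {t'' : ℝ} (ht'' : t'' ∈ Icc 0 (cd.h j v))
    (i : Fin 4) (k : ℤ) (hk1 : -cd.Kb ≤ k) (hk2 : k ≤ cd.Ka) :
    ∀ y₁ y₂ : Fin 4 → ℤ → ℝ, cd.InBall j (y₁ - stAt φ j y₀ (cd.Tn j v - t)) (cd.κ j) →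
      cd.InBall j (y₂ - stAt φ j y₀ (cd.Tn j v - t)) (cd.κ j) →
      ∀ r : ℝ, cd.InBall j (y₁ - y₂) r → |φ j y₁ i k t'' - φ j y₂ i k t''| ≤ (cd.L1 j v * cd.ω j k) * r := by
  intro y₁ y₂ hy₁ hy₂ r hr
  have hω := omega_pos hV hj
  have hκ := kappa_pos hV hj
  have hp := inBall_restart_node hV hC hj hq hs' h1 h2 hy₀ hv hvS
  have hm : 0 ≤ cd.mT j v + cd.SpO j v := inBall_nonneg hV hω hp
  have hh : cd.h j v ∈ Icc 0 (cd.h j v) := ⟨(h_pos hV hj hvS).le, le_rfl⟩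
  have hg := guard_of_le_h hV hj hvS (m := cd.mT j v + cd.SpO j v) (ρ := cd.κ j) (by linarith) le_rfl hh
  have h := inBall_sub_of_F4 hF hj hm hκ.le hp hh.1 hg hy₁ hy₂ hr ht'' i k hk1 hk2
  have hr0 : 0 ≤ r := inBall_nonneg hV hω hr
  have hfac := factor_le_L1 hV hj hvS (m := cd.mT j v + cd.SpO j v) (ρ := cd.κ j) (by linarith) le_rfl ht''
  simp only [Pi.sub_apply, stAt] at h
  calc |φ j y₁ i k t'' - φ j y₂ i k t''| ≤ 1 / (1 - cd.bb j * (cd.mT j v + cd.SpO j v + cd.κ j) * t'') ^ 2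
        * r * cd.ω j k := h
    _ ≤ cd.L1 j v * r * cd.ω j k :=
        mul_le_mul_of_nonneg_right (mul_le_mul_of_nonneg_right hfac hr0) (hω k).le
    _ = cd.L1 j v * cd.ω j k * r := by ring

/-- NODE DIRECTIONAL DERIVATIVE: at the node state `p = φ(y₀, Tn v − t)` of a κ-restarted flow,
`θ ↦ φ(p + θ η, t'')` is differentiable at `θ = 0` for every direction `η`. [folklore] -/
theorem node_dir (hV : cd.Valid) (hF : IsFlowPackage cd φ) (hC : ChainEnclosure cd φ) (hj : j ≤ cd.N₀)
    {q : Fin 4 → ℤ → ℝ} (hq : InPoly cd j q) {s' : ℕ} (hs' : s' < cd.S j) {t : ℝ} (h1 : cd.Tn j s' ≤ t)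
    (h2 : t ≤ cd.Tn j (s' + 1)) {y₀ : Fin 4 → ℤ → ℝ} (hy₀ : cd.InBall j (y₀ - stAt φ j q t) (cd.κ j))
    {v : ℕ} (hv : s' < v) (hvS : v < cd.S j) {t'' : ℝ} (ht'' : t'' ∈ Icc 0 (cd.h j v))
    (i : Fin 4) (k : ℤ) (hk1 : -cd.Kb ≤ k) (hk2 : k ≤ cd.Ka) (η : Fin 4 → ℤ → ℝ) :
    ∃ a : ℝ, HasDerivAt (fun θ : ℝ => φ j (stAt φ j y₀ (cd.Tn j v - t) + θ • η) i k t'') a 0 := by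
  have hω := omega_pos hV hj
  have hκ := kappa_pos hV hj
  have hp := inBall_restart_node hV hC hj hq hs' h1 h2 hy₀ hv hvS
  have hm : 0 ≤ cd.mT j v + cd.SpO j v := inBall_nonneg hV hω hp
  have hh : cd.h j v ∈ Icc 0 (cd.h j v) := ⟨(h_pos hV hj hvS).le, le_rfl⟩
  have hg := guard_of_le_h hV hj hvS (m := cd.mT j v + cd.SpO j v) (ρ := cd.κ j) (by linarith) le_rfl hh
  obtain ⟨N, hN0, hηN⟩ := exists_radius hω η
  set p : Fin 4 → ℤ → ℝ := stAt φ j y₀ (cd.Tn j v - t) with hp_def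
  set ε : ℝ := cd.κ j / (N + 1) with hε
  have hεpos : 0 < ε := div_pos hκ (by linarith)
  have hεN : |ε| * N ≤ cd.κ j := by
    rw [abs_of_pos hεpos, hε, div_mul_eq_mul_div, div_le_iff₀ (by linarith)]
    nlinarith [hκ.le]
  have hεη : cd.InBall j (ε • η) (cd.κ j) := inBall_mono hω (inBall_smul ε hηN) hεN
  have hplus : cd.InBall j ((p + ε • η) - p) (cd.κ j) := by rwa [add_sub_cancel_left]
  have hminus : cd.InBall j ((p - ε • η) - p) (cd.κ j) := by
    rw [sub_sub_cancel_left]; exact inBall_neg hεη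
  have hdiff : cd.InBall j ((p + ε • η) - (p - ε • η)) (cd.κ j + cd.κ j) := by
    have e : (p + ε • η) - (p - ε • η) = ε • η + ε • η := by abel
    rw [e]; exact inBall_add hεη hεη
  obtain ⟨ψ, hψ⟩ := (hF j hj).2.2.2.2.1 p (cd.mT j v + cd.SpO j v) (cd.κ j) (cd.h j v) hm hκ.le hp hh.1 hg
    (p + ε • η) (p - ε • η) (cd.κ j + cd.κ j) hplus hminus hdiff i k hk1 hk2 t'' ht''
  exact ⟨_, hasDerivAt_dir_of_segment (g := fun y => φ j y i k t'') hεpos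
    ((hψ (1 / 2) ⟨by norm_num, by norm_num⟩).1)⟩

/-! ### Existence of the σ-derivative across the nodes -/

/-- ADVANCE FROM A NODE: if `σ ↦ φ(y σ, Tn v − t)` is differentiable (all window components) at every
`σ₀ ∈ [0,1]`, then so is `σ ↦ φ(y σ, Tn v − t + t'')` for `t'' ≤ h v` (curve chain rule at the node state +
flow property). [folklore] -/
theorem deriv_advance (hV : cd.Valid) (hF : IsFlowPackage cd φ) (hC : ChainEnclosure cd φ) (hj : j ≤ cd.N₀)
    {q : Fin 4 → ℤ → ℝ} (hq : InPoly cd j q) {s' : ℕ} (hs' : s' < cd.S j) {t : ℝ} (h1 : cd.Tn j s' ≤ t)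
    (h2 : t ≤ cd.Tn j (s' + 1)) {z z' : Fin 4 → ℤ → ℝ}
    (hz : cd.InBall j (z - stAt φ j q t) (cd.κ j)) (hz' : cd.InBall j (z' - stAt φ j q t) (cd.κ j))
    {v : ℕ} (hv : s' + 1 ≤ v) (hvS : v < cd.S j)
    (IH : ∀ σ₀ ∈ Icc (0:ℝ) 1, ∀ i k, -cd.Kb ≤ k → k ≤ cd.Ka →
      ∃ a : ℝ, HasDerivWithinAt (fun σ : ℝ => φ j (z' + σ • (z - z')) i k (cd.Tn j v - t)) a (Icc 0 1) σ₀)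
    {t'' : ℝ} (ht'' : t'' ∈ Icc 0 (cd.h j v)) :
    ∀ σ₀ ∈ Icc (0:ℝ) 1, ∀ i k, -cd.Kb ≤ k → k ≤ cd.Ka →
      ∃ a : ℝ, HasDerivWithinAt (fun σ : ℝ => φ j (z' + σ • (z - z')) i k (cd.Tn j v - t + t'')) a
        (Icc 0 1) σ₀ := by
  intro σ₀ hσ₀ i k hk1 hk2
  have hω := omega_pos hV hj
  have hκ := kappa_pos hV hj
  choose! η hη using IH σ₀ hσ₀
  have hy₀ : cd.InBall j (z' + σ₀ • (z - z') - stAt φ j q t) (cd.κ j) := inBall_convex hz hz' hσ₀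
  have hLip := node_lip hV hF hC hj hq hs' h1 h2 hy₀ (by omega) hvS ht'' i k hk1 hk2
  obtain ⟨a, ha⟩ := node_dir hV hF hC hj hq hs' h1 h2 hy₀ (by omega) hvS ht'' i k hk1 hk2 η
  refine ⟨a, ?_⟩
  have hmain := hasDerivWithinAt_comp_curve (cd := cd) (j := j) hω (g := fun y => φ j y i k t'')
    (p := stAt φ j (z' + σ₀ • (z - z')) (cd.Tn j v - t)) (η := η)
    (γ := fun σ => stAt φ j (z' + σ • (z - z')) (cd.Tn j v - t)) (s := Icc 0 1) (σ₀ := σ₀) (a := a)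
    (ρ₀ := cd.κ j) (C := cd.L1 j v * cd.ω j k) hκ hLip ha (fun _ _ _ _ => rfl)
    (fun i' k' hk1' hk2' => by simpa only [stAt] using hη i' k' hk1' hk2')
  refine hmain.congr_of_mem (fun σ hσ => ?_) hσ₀
  have hT1 : cd.Tn j (s' + 1) ≤ cd.Tn j v := Tn_mono hV hj hv hvS.le
  have hT2 : cd.Tn j (v + 1) ≤ cd.Tn j (cd.S j) := Tn_mono hV hj (by omega) le_rfl
  have hTn := Tn_succ hV hj hvS
  have hflow := stAt_restart_at hV hF hC hj hq hs' h1 h2 (inBall_convex hz hz' hσ) hv hvS.le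
    (T' := cd.Tn j v - t + t'') (by linarith [ht''.1]) (by linarith [ht''.2])
  have e : t + (cd.Tn j v - t + t'') - cd.Tn j v = t'' := by ring
  rw [e] at hflow
  have h := congr_fun (congr_fun hflow i) k
  simpa only [stAt] using h

/-- NODE DERIVATIVES: `σ ↦ φ(y σ, Tn v − t)` is differentiable within `[0,1]` at every `σ₀`, for every node
`v` with `s' + 1 ≤ v < S` (induction over the nodes). [folklore] -/
theorem deriv_node (hV : cd.Valid) (hF : IsFlowPackage cd φ) (hC : ChainEnclosure cd φ) (hj : j ≤ cd.N₀)
    {q : Fin 4 → ℤ → ℝ} (hq : InPoly cd j q) {s' : ℕ} (hs' : s' < cd.S j) {t : ℝ} (h1 : cd.Tn j s' ≤ t)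
    (h2 : t ≤ cd.Tn j (s' + 1)) {z z' : Fin 4 → ℤ → ℝ} {d : ℝ}
    (hz : cd.InBall j (z - stAt φ j q t) (cd.κ j)) (hz' : cd.InBall j (z' - stAt φ j q t) (cd.κ j))
    (hzz : cd.InBall j (z - z') d) :
    ∀ v, s' + 1 ≤ v → v < cd.S j → ∀ σ₀ ∈ Icc (0:ℝ) 1, ∀ i k, -cd.Kb ≤ k → k ≤ cd.Ka →
      ∃ a : ℝ, HasDerivWithinAt (fun σ : ℝ => φ j (z' + σ • (z - z')) i k (cd.Tn j v - t)) a (Icc 0 1) σ₀ := by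
  intro v hv
  induction v, hv using Nat.le_induction with
  | base =>
    intro _ σ₀ hσ₀ i k hk1 hk2
    obtain ⟨ψ, hψ⟩ := first_leg hV hF hC hj hq hs' h1 h2 hz hz' hzz (t' := cd.Tn j (s' + 1) - t)
      ⟨by linarith, le_rfl⟩ i k hk1 hk2
    exact ⟨ψ σ₀, (hψ σ₀ hσ₀).1⟩
  | succ v hv ih =>
    intro hvS σ₀ hσ₀ i k hk1 hk2
    have hvS' : v < cd.S j := by omega
    have h := deriv_advance hV hF hC hj hq hs' h1 h2 hz hz' hv hvS' (ih hvS') (t'' := cd.h j v)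
      ⟨(h_pos hV hj hvS').le, le_rfl⟩ σ₀ hσ₀ i k hk1 hk2
    have e : cd.Tn j v - t + cd.h j v = cd.Tn j (v + 1) - t := by rw [Tn_succ hV hj hvS']; ring
    rw [e] at h
    exact h

/-! ### Non-negativity of the frame coefficients -/

/-- The variation defect coefficient `RemV + (1/(1−bb(mC+ρO)h)² − 1/(1−bb·mC·h)²)` of a sub-step is
non-negative. [folklore] -/
theorem K_nonneg (hV : cd.Valid) (hj : j ≤ cd.N₀) {s : ℕ} (hs : s < cd.S j) :
    0 ≤ cd.RemV (cd.bb j) (cd.mC j s) (cd.h j s) +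
      (1 / (1 - cd.bb j * (cd.mC j s + cd.ρO j s) * cd.h j s) ^ 2 -
        1 / (1 - cd.bb j * cd.mC j s * cd.h j s) ^ 2) := by
  have hA := (hV.2.2.1 j hj).2.2.2.2.2.2.1 s hs.le
  have hB := (hV.2.2.1 j hj).2.2.2.2.2.2.2 s hs
  have hmC : 0 ≤ cd.mC j s := hA.2.2.1
  have hEI : 0 ≤ cd.EI j s := hA.2.2.2.2.2.1
  have hE : cd.EI j s ≤ cd.E j s := hA.2.2.2.2.2.2.1
  have hEO : cd.E j s ≤ cd.EO j s := hA.2.2.2.2.2.2.2.1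
  have hρO : cd.EO j s ≤ cd.ρO j s := hA.2.2.2.2.2.2.2.2.1
  have hg2 : cd.bb j * cd.mC j s * cd.h j s < 1 := hB.2.1
  have hg3 : cd.bb j * (cd.mC j s + cd.ρO j s) * cd.h j s < 1 := hB.2.2.1
  have hh := (h_pos hV hj hs).le
  have hbb := bb_nonneg hV hj
  set x : ℝ := cd.bb j * cd.mC j s * cd.h j s with hx
  have hx0 : 0 ≤ x := mul_nonneg (mul_nonneg hbb hmC) hh
  have hRemV : 0 ≤ cd.RemV (cd.bb j) (cd.mC j s) (cd.h j s) := by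
    simp only [CertData.RemV]
    rw [← hx]
    apply div_nonneg _ (pow_nonneg (by linarith) 2)
    have e : ((cd.pdeg : ℝ) + 2) * x ^ (cd.pdeg + 1) - ((cd.pdeg : ℝ) + 1) * x ^ (cd.pdeg + 2)
        = x ^ (cd.pdeg + 1) * (((cd.pdeg : ℝ) + 2) - ((cd.pdeg : ℝ) + 1) * x) := by ring
    rw [e]
    apply mul_nonneg (pow_nonneg hx0 _)
    nlinarith [hx0, hg2.le, (Nat.cast_nonneg cd.pdeg : (0:ℝ) ≤ cd.pdeg)]
  have hmono : 1 / (1 - cd.bb j * cd.mC j s * cd.h j s) ^ 2 ≤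
      1 / (1 - cd.bb j * (cd.mC j s + cd.ρO j s) * cd.h j s) ^ 2 :=
    one_div_sq_mono (mul_le_mul_of_nonneg_right (mul_le_mul_of_nonneg_left (by linarith) hbb) hh) hg3
  linarith

/-- `κB` of a sub-step is non-negative. [folklore] -/
theorem kappaB_nonneg (hV : cd.Valid) (hj : j ≤ cd.N₀) {s : ℕ} (hs : s < cd.S j) : 0 ≤ cd.κB j s := by
  have hA := (hV.2.2.1 j hj).2.2.2.2.2.2.1 s hs.le
  have hB := (hV.2.2.1 j hj).2.2.2.2.2.2.2 s hs
  have h22 := hB.2.2.2.2.2.2.2.2.2.2.2.2.2.2.2.2.2.2.2.2.2.1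
  have hρO : cd.EO j s ≤ cd.ρO j s := hA.2.2.2.2.2.2.2.2.1
  have hN : 0 ≤ cd.NCi j (s + 1) := (NCi_clause hV hj (Nat.succ_le_of_lt hs)).1
  exact le_trans (mul_nonneg (mul_nonneg hN (K_nonneg hV hj hs)) (by linarith)) h22

end Summit.NavierStokesRegularity.NavierStokesRegularity.Theorems.TaylorModelReadout.G3

end
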